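import Mathlib
import Summits.Schanuel.Schanuel.Theses.RigidCore
import Literature.NumberTheory.Transcendental.KernelTranslatesRankTwoSectors
import Literature.NumberTheory.Transcendental.LindemannWeierstrassProofs
import Literature.NumberTheory.Transcendental.RoyCriterion
import Summits.Schanuel.Schanuel.Theorems.MinimalCounterexampleInAcl.Negative.IsolationFree

/-!
# Disproof work file, companion to `Disproof.lean` §18–§19 (crux `RigidCore.MinimalCounterexampleInAcl`, stmt-Schanuel-0969) — RANK 2: `𝒵_W ⊆ Z(m₀) × Z(m₁)` closed discrete, and the ESCAPE IS VERTICAL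

cdisprove gen 4.  Everything PROVED (rc 0, no `sorry`).  For `x ∈ ℂ²` with `trdeg ℚ(x, eˣ) < 2` (a rank-2
first failure; neither linear independence nor `SchanuelRank` is used in this file), `W` = ℚ-locus of
`(x, eˣ)`, `𝒵_W = {v | (v, e^v) ∈ W}` (its ℚ-independent points = the locus mates, whose finiteness is
the rank-2 residue of the crux: `ExpSectorTwo` / stub `stub_expImageFinite_offLog` / `SparsityTwo` on
first-failure curves).

* §18 `exists_coord_expPoly`: each coordinate of every `v ∈ 𝒵_W` is a zero of a FIXED non-zero
  exponential polynomial `mᵢ(e^s, s)`, `mᵢ ∈ ℚ[T, S]`; `expPoly_zeros_finite` (Hermite–Lindemann at a good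
  rational point + identity theorem); `locusPts_bounded_finite` (**bounded sets of locus points are
  FINITE**; `𝒵_W ⊆ Z(m₀) × Z(m₁)` is closed discrete), `locusPts_bounded_finite_of_special` (any rank,
  E-special tuples), `cruxRankTwo_of_bounded'` (with the landed `Negative.isolationFree`).
* §19 growth of zeros of exponential polynomials (`cauchy_bound`, `expPoly_eq_sum` normal form
  `Σ_{j≤d} g_j(s) e^{js}`, `norm_exp_le_of_expPoly_eq_zero` / `norm_exp_neg_le_of_expPoly_eq_zero`: for
  large zeros `max(‖e^s‖, ‖e^{-s}‖) ≤ max 1 (C (1+‖s‖)^D)` — leading/trailing coefficient dominance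
  (Pólya) — `abs_re_le_of_expPoly_eq_zero`: `|Re s| = O(log ‖s‖)`, `norm_lt_of_expPoly_eq_zero_of_im_le`:
  zeros with `|Im s| ≤ T` are bounded).  Hence `locusPts_finite_of_im_bounded`: **the locus points with
  bounded imaginary parts are FINITE — the only way for the mates of a rank-2 first failure to be infinite
  is VERTICAL ESCAPE `|Im x'ᵢ| → ∞`, with `|Re x'ᵢ| = O(log |x'ᵢ|)` and `‖e^{±x'ᵢ}‖` polynomially bounded**
  (kernel translates `x + 2πik` are the prototype; the non-translate vertical escape is the residue).

## References

* [Lindemann1882] F. Lindemann, *Über die Zahl π*, Math. Ann. 20 (1882) (tree `transcendental_exp_holds`).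
* [Polya1920] G. Pólya, *Geometrisches über die Verteilung der Nullstellen gewisser ganzer transzendenter
  Funktionen*, Münch. Sitzungsber. 50 (1920) (zeros of exponential polynomials lie in logarithmic strips).
-/

noncomputable section

set_option linter.dupNamespace false

open Complex Polynomial Set Filter Topology Bornology Finset
open Literature.NumberTheory.Transcendental
open Literature.NumberTheory.Transcendental.KernelTranslatesRankTwo (eval_map_finSuccEquiv
  finite_setOf_aeval_eq_zero exists_mvPolynomial_of_trdeg_lt_two)
open Summit.Schanuel.Schanuel.Theorems.MinimalCounterexampleInAcl.Negative (isolationFree)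
open Summit.Schanuel.Schanuel.Theorems.AclSubsetLogFreeCore.Negative (expAcl)

namespace Summit.Schanuel.Schanuel.Cruxes.MinimalCounterexampleInAcl.DisproofRankTwo

/-! ## §18 `𝒵_W ⊆ Z(m₀) × Z(m₁)` -/


/-- The one-variable exponential polynomial `s ↦ m(e^s, s)` attached to `m ∈ ℚ[T, S]`. -/
def expPoly (m : MvPolynomial (Fin 2) ℚ) (s : ℂ) : ℂ := MvPolynomial.aeval ![cexp s, s] m

theorem expPoly_def (m : MvPolynomial (Fin 2) ℚ) (s : ℂ) :
    expPoly m s = MvPolynomial.aeval ![cexp s, s] m := rfl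

/-- `s ↦ m(e^s, s)` is analytic everywhere. -/
theorem analyticAt_expPoly (m : MvPolynomial (Fin 2) ℚ) (s₀ : ℂ) : AnalyticAt ℂ (expPoly m) s₀ := by
  unfold expPoly
  induction m using MvPolynomial.induction_on with
  | C a =>
    have e : (fun s : ℂ => MvPolynomial.aeval ![cexp s, s] (MvPolynomial.C a)) = fun _ => (a : ℂ) := by
      funext s; simp
    rw [e]; exact analyticAt_const
  | add p q hp hq =>
    have e : (fun s : ℂ => MvPolynomial.aeval ![cexp s, s] (p + q)) =
        fun s => MvPolynomial.aeval ![cexp s, s] p + MvPolynomial.aeval ![cexp s, s] q := by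
      funext s; simp
    rw [e]; exact hp.add hq
  | mul_X p i hp =>
    have e : (fun s : ℂ => MvPolynomial.aeval ![cexp s, s] (p * MvPolynomial.X i)) =
        fun s => MvPolynomial.aeval ![cexp s, s] p * (![cexp s, s] i) := by
      funext s; simp
    rw [e]
    refine hp.mul ?_
    fin_cases i
    · exact analyticAt_cexp
    · exact analyticAt_id

/-- **A non-zero `m ∈ ℚ[T, S]` gives a non-zero exponential polynomial**: there is a rational `q ≠ 0`
with `m(e^q, q) ≠ 0` (Hermite–Lindemann: `e^q` is transcendental, so it is not a root of the non-zero
rational polynomial `m(·, q)` — non-zero for all `q` off the finitely many roots of the leading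
coefficient). -/
theorem exists_rat_expPoly_ne_zero {m : MvPolynomial (Fin 2) ℚ} (hm : m ≠ 0) :
    ∃ q : ℚ, q ≠ 0 ∧ expPoly m q ≠ 0 := by
  classical
  set M : Polynomial (MvPolynomial (Fin 1) ℚ) := MvPolynomial.finSuccEquiv ℚ 1 m with hM
  have hM0 : M ≠ 0 := by
    rw [hM]; exact (EmbeddingLike.map_ne_zero_iff).2 hm
  set L : MvPolynomial (Fin 1) ℚ := M.leadingCoeff with hL
  have hL0 : L ≠ 0 := Polynomial.leadingCoeff_ne_zero.2 hM0
  -- the leading coefficient, as a polynomial in `S`, has finitely many complex roots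
  set L2 : MvPolynomial (Fin 2) ℚ := MvPolynomial.rename (fun _ : Fin 1 => (0 : Fin 2)) L with hL2
  have hL20 : L2 ≠ 0 := by
    rw [hL2]
    exact (MvPolynomial.rename_injective _ (fun a b _ => Subsingleton.elim a b)).ne hL0
  have heval2 : ∀ z y : ℂ, MvPolynomial.aeval ![z, y] L2 = MvPolynomial.aeval (fun _ : Fin 1 => z) L := by
    intro z y
    rw [hL2, MvPolynomial.aeval_rename]
    rfl
  have htrans : Transcendental ℚ (cexp 1) := by
    intro h
    exact transcendental_exp_holds (isAlgebraic_one) one_ne_zero h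
  have hfin : {z : ℂ | MvPolynomial.aeval (fun _ : Fin 1 => z) L = 0}.Finite := by
    have h := finite_setOf_aeval_eq_zero hL20 htrans
    refine h.subset ?_
    intro z hz
    simp only [Set.mem_setOf_eq] at hz ⊢
    rw [heval2]; exact hz
  -- pick a non-zero rational off that finite set
  have hinf : (Set.range (fun q : ℚ => (q : ℂ)) \ {0}).Infinite := by
    refine Set.Infinite.sdiff ?_ (Set.finite_singleton 0)
    exact Set.infinite_range_of_injective Rat.cast_injective
  obtain ⟨c, ⟨⟨q, rfl⟩, hq0⟩, hqL⟩ := (hinf.sdiff hfin).nonempty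
  have hq : (q : ℂ) ≠ 0 := hq0
  have hqL' : MvPolynomial.aeval (fun _ : Fin 1 => (q : ℂ)) L ≠ 0 := hqL
  refine ⟨q, by exact_mod_cast hq, ?_⟩
  -- `m(·, q)` as a rational polynomial
  set Mq : Polynomial ℚ := M.map (MvPolynomial.aeval (fun _ : Fin 1 => q) :
      MvPolynomial (Fin 1) ℚ →ₐ[ℚ] ℚ).toRingHom with hMq
  have hcoef : ∀ r : MvPolynomial (Fin 1) ℚ, (MvPolynomial.aeval (fun _ : Fin 1 => (q : ℂ)) r : ℂ) =
      algebraMap ℚ ℂ (MvPolynomial.aeval (fun _ : Fin 1 => q) r) := by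
    intro r
    have e : (fun _ : Fin 1 => (q : ℂ)) = algebraMap ℚ ℂ ∘ fun _ : Fin 1 => q := by
      funext i; rfl
    rw [e, MvPolynomial.aeval_algebraMap_apply]
  have hMqC : M.map (MvPolynomial.aeval (fun _ : Fin 1 => (q : ℂ)) :
      MvPolynomial (Fin 1) ℚ →ₐ[ℚ] ℂ).toRingHom = Mq.map (algebraMap ℚ ℂ) := by
    rw [hMq, Polynomial.map_map]
    congr 1
    exact RingHom.ext fun r => hcoef r
  have hMq0 : Mq ≠ 0 := by
    intro h0
    apply hqL'
    have hlc : (MvPolynomial.aeval (fun _ : Fin 1 => q) L) = 0 := by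
      have := congrArg Polynomial.leadingCoeff h0
      rw [Polynomial.leadingCoeff_zero] at this
      by_contra hne
      rw [hMq, Polynomial.leadingCoeff_map_of_leadingCoeff_ne_zero _ (by exact hne)] at this
      exact hne this
    rw [hcoef, hlc, map_zero]
  intro hzero
  -- then `e^q` would be algebraic
  have halg : IsAlgebraic ℚ (cexp q) := by
    refine ⟨Mq, hMq0, ?_⟩
    rw [Polynomial.aeval_def, ← Polynomial.eval_map, ← hMqC, eval_map_finSuccEquiv]
    exact hzero
  have hqalg : IsAlgebraic ℚ ((q : ℚ) : ℂ) := by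
    have h := isAlgebraic_algebraMap (R := ℚ) (A := ℂ) q
    rwa [eq_ratCast] at h
  exact transcendental_exp_holds hqalg hq halg

/-- **Zeros of a non-zero exponential polynomial are isolated** (identity theorem on `ℂ`). -/
theorem expPoly_eventually_ne {m : MvPolynomial (Fin 2) ℚ} (hm : m ≠ 0) (z₀ : ℂ) :
    ∀ᶠ s in 𝓝[≠] z₀, expPoly m s ≠ 0 := by
  rcases (analyticAt_expPoly m z₀).eventually_eq_zero_or_eventually_ne_zero with h | h
  · exfalso
    obtain ⟨q, -, hq⟩ := exists_rat_expPoly_ne_zero hm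
    have hall := AnalyticOnNhd.eqOn_zero_of_preconnected_of_eventuallyEq_zero
      (f := expPoly m) (U := Set.univ) (fun s _ => analyticAt_expPoly m s)
      isPreconnected_univ (Set.mem_univ z₀) h
    exact hq (hall (Set.mem_univ _))
  · exact h

/-- Hence **bounded sets of zeros of a non-zero exponential polynomial are finite**. -/
theorem expPoly_zeros_finite {m : MvPolynomial (Fin 2) ℚ} (hm : m ≠ 0) (R : ℝ) :
    {s : ℂ | ‖s‖ ≤ R ∧ expPoly m s = 0}.Finite := by
  by_contra hinf
  have hinf' : {s : ℂ | ‖s‖ ≤ R ∧ expPoly m s = 0}.Infinite := hinf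
  have hsub : {s : ℂ | ‖s‖ ≤ R ∧ expPoly m s = 0} ⊆ Metric.closedBall (0 : ℂ) R := by
    intro s hs; simpa using hs.1
  obtain ⟨z₀, -, hacc⟩ := hinf'.exists_accPt_of_subset_isCompact (isCompact_closedBall 0 R) hsub
  rw [accPt_iff_frequently_nhdsNE] at hacc
  have h := expPoly_eventually_ne hm z₀
  obtain ⟨s, hs, hs'⟩ := (hacc.and_eventually h).exists
  exact hs' hs.2

/-- **E-SPECIAL TUPLES, ANY RANK: bounded sets of locus points are finite.**  If every coordinate of
`x ∈ ℂⁿ` is *E-special* — `xᵢ` and `e^{xᵢ}` algebraically dependent, witnessed by `mᵢ ≠ 0` in `ℚ[T, S]`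
with `mᵢ(e^{xᵢ}, xᵢ) = 0` (automatic at rank 2, and in the log sector at every rank) — then the tuples `v`
satisfying every ℚ-relation of `(x, eˣ)` with `‖vᵢ‖ ≤ R` form a finite set: `𝒵_W ⊆ ∏ᵢ Z(mᵢ)` is closed
discrete with no finite accumulation point. -/
theorem locusPts_bounded_finite_of_special {n : ℕ} {x : Fin n → ℂ}
    (hdep : ∀ i, ∃ m : MvPolynomial (Fin 2) ℚ, m ≠ 0 ∧ MvPolynomial.aeval ![cexp (x i), x i] m = 0)
    (R : ℝ) :
    {v : Fin n → ℂ | (∀ i, ‖v i‖ ≤ R) ∧ ∀ p : MvPolynomial (Fin n ⊕ Fin n) ℚ,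
        MvPolynomial.aeval (Sum.elim x (cexp ∘ x)) p = 0 →
        MvPolynomial.aeval (Sum.elim v (cexp ∘ v)) p = 0}.Finite := by
  choose m hm0 hm using hdep
  -- the relation `mᵢ(Yᵢ, Xᵢ)` of `(x, eˣ)` transfers to every `v` on the locus
  have htrans : ∀ i (v : Fin n → ℂ), (∀ p : MvPolynomial (Fin n ⊕ Fin n) ℚ,
      MvPolynomial.aeval (Sum.elim x (cexp ∘ x)) p = 0 →
      MvPolynomial.aeval (Sum.elim v (cexp ∘ v)) p = 0) → expPoly (m i) (v i) = 0 := by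
    intro i v hv
    set r : Fin 2 → Fin n ⊕ Fin n := ![Sum.inr i, Sum.inl i] with hr
    have hre : ∀ w : Fin n → ℂ, MvPolynomial.aeval (Sum.elim w (cexp ∘ w)) (MvPolynomial.rename r (m i)) =
        expPoly (m i) (w i) := by
      intro w
      have e : (Sum.elim w (cexp ∘ w) ∘ r) = ![cexp (w i), w i] := by
        funext j; fin_cases j <;> rfl
      rw [MvPolynomial.aeval_rename, expPoly_def, e]
    have h0 : MvPolynomial.aeval (Sum.elim x (cexp ∘ x)) (MvPolynomial.rename r (m i)) = 0 := by
      rw [hre]; exact hm i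
    have := hv _ h0
    rwa [hre] at this
  have hZ : ∀ i, {s : ℂ | ‖s‖ ≤ R ∧ expPoly (m i) s = 0}.Finite := fun i => expPoly_zeros_finite (hm0 i) R
  refine (Set.Finite.pi hZ).subset ?_
  intro v hv
  rw [Set.mem_univ_pi]
  intro i
  exact ⟨hv.1 i, htrans i v hv.2⟩

/-- **At rank 2 every coordinate is E-special** (`trdeg ℚ(xᵢ, e^{xᵢ}) ≤ trdeg ℚ(x, eˣ) ≤ 1`), so
**BOUNDED SETS OF TUPLES ON THE LOCUS ARE FINITE**: for `x ∈ ℂ²` with `trdeg ℚ(x,eˣ) < 2` (e.g. a rank-2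
first failure — but neither linear independence nor `SchanuelRank` is used) the tuples `v` satisfying
every ℚ-relation of `(x, eˣ)` with norm `≤ R` form a finite set; `𝒵_W ⊆ Z(m₀) × Z(m₁)` is a closed
discrete set with NO finite accumulation point, and the locus mates are finite iff BOUNDED. -/
theorem locusPts_bounded_finite {x : Fin 2 → ℂ}
    (htr : Algebra.trdeg ℚ ↥(IntermediateField.adjoin ℚ (range x ∪ range (cexp ∘ x))) < (2 : Cardinal))
    (R : ℝ) :
    {v : Fin 2 → ℂ | (∀ i, ‖v i‖ ≤ R) ∧ ∀ p : MvPolynomial (Fin 2 ⊕ Fin 2) ℚ,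
        MvPolynomial.aeval (Sum.elim x (cexp ∘ x)) p = 0 →
        MvPolynomial.aeval (Sum.elim v (cexp ∘ v)) p = 0}.Finite := by
  refine locusPts_bounded_finite_of_special (fun i => ?_) R
  exact exists_mvPolynomial_of_trdeg_lt_two htr
    (IntermediateField.subset_adjoin ℚ _ (Or.inr ⟨i, rfl⟩))
    (IntermediateField.subset_adjoin ℚ _ (Or.inl ⟨i, rfl⟩))


/-- **At rank 2 each coordinate of every tuple on the locus satisfies a FIXED non-zero exponential
polynomial equation**: for `x : Fin 2 → ℂ` with `trdeg ℚ(x, eˣ) < 2` and `i`, there is `m ≠ 0` in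
`ℚ[T, S]` with `m(e^{vᵢ}, vᵢ) = 0` for every `v` satisfying the ℚ-relations of `(x, eˣ)`. -/
theorem exists_coord_expPoly {x : Fin 2 → ℂ}
    (htr : Algebra.trdeg ℚ ↥(IntermediateField.adjoin ℚ (range x ∪ range (cexp ∘ x))) < (2 : Cardinal))
    (i : Fin 2) :
    ∃ m : MvPolynomial (Fin 2) ℚ, m ≠ 0 ∧ ∀ v : Fin 2 → ℂ,
      (∀ p : MvPolynomial (Fin 2 ⊕ Fin 2) ℚ,
        MvPolynomial.aeval (Sum.elim x (cexp ∘ x)) p = 0 →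
        MvPolynomial.aeval (Sum.elim v (cexp ∘ v)) p = 0) → expPoly m (v i) = 0 := by
  have ha : cexp (x i) ∈ IntermediateField.adjoin ℚ (range x ∪ range (cexp ∘ x)) :=
    IntermediateField.subset_adjoin ℚ _ (Or.inr ⟨i, rfl⟩)
  have hb : x i ∈ IntermediateField.adjoin ℚ (range x ∪ range (cexp ∘ x)) :=
    IntermediateField.subset_adjoin ℚ _ (Or.inl ⟨i, rfl⟩)
  obtain ⟨m, hm0, hm⟩ := exists_mvPolynomial_of_trdeg_lt_two htr ha hb
  refine ⟨m, hm0, fun v hv => ?_⟩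
  -- the relation `m(Yᵢ, Xᵢ)` of `(x, eˣ)` transfers to `v`
  set r : Fin 2 → Fin 2 ⊕ Fin 2 := ![Sum.inr i, Sum.inl i] with hr
  have hre : ∀ w : Fin 2 → ℂ, MvPolynomial.aeval (Sum.elim w (cexp ∘ w)) (MvPolynomial.rename r m) =
      expPoly m (w i) := by
    intro w
    have e : (Sum.elim w (cexp ∘ w) ∘ r) = ![cexp (w i), w i] := by
      funext j; fin_cases j <;> rfl
    rw [MvPolynomial.aeval_rename, expPoly_def, e]
  have h0 : MvPolynomial.aeval (Sum.elim x (cexp ∘ x)) (MvPolynomial.rename r m) = 0 := by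
    rw [hre]; exact hm
  have := hv _ h0
  rwa [hre] at this


/-- **`CruxRankTwo` (the crux at its first open rank, inlined) follows from BOUNDEDNESS of the mates of
rank-2 first failures**, with the landed free definable isolation `Negative.isolationFree`. -/
theorem cruxRankTwo_of_bounded'
    (h : ∀ x : Fin 2 → ℂ, LinearIndependent ℚ x →
      Algebra.trdeg ℚ ↥(IntermediateField.adjoin ℚ (Set.range x ∪ Set.range (cexp ∘ x))) < (2 : Cardinal) →
      Bornology.IsBounded {x' : Fin 2 → ℂ | LinearIndependent ℚ x' ∧
        ∀ p : MvPolynomial (Fin 2 ⊕ Fin 2) ℚ,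
          MvPolynomial.aeval (Sum.elim x (cexp ∘ x)) p = 0 →
          MvPolynomial.aeval (Sum.elim x' (cexp ∘ x')) p = 0}) :
    ∀ x : Fin 2 → ℂ, LinearIndependent ℚ x →
      Algebra.trdeg ℚ ↥(IntermediateField.adjoin ℚ (Set.range x ∪ Set.range (cexp ∘ x))) < (2 : Cardinal) →
      ∀ i, x i ∈ expAcl := by
  intro x hli htr i
  refine isolationFree hli ?_ i
  obtain ⟨R, hR⟩ := (h x hli htr).subset_closedBall 0
  refine (locusPts_bounded_finite htr R).subset fun x' hx' => ⟨fun j => ?_, hx'.2⟩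
  have h1 := hR hx'
  rw [Metric.mem_closedBall, dist_zero_right] at h1
  exact (norm_le_pi_norm x' j).trans h1

/-! ## §19 Growth of the zeros of exponential polynomials: the escape is VERTICAL -/


/-! ### Cauchy's root bound -/

/-- **Cauchy bound**: if `Σ_{j ≤ d} a j * w^j = 0` with `a d ≠ 0` then `‖w‖ ≤ max 1 ((Σ_{j<d} ‖a j‖)/‖a d‖)`. -/
theorem cauchy_bound {d : ℕ} (a : ℕ → ℂ) (w : ℂ) (hd : a d ≠ 0)
    (hz : ∑ j ∈ range (d + 1), a j * w ^ j = 0) :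
    ‖w‖ ≤ max 1 ((∑ j ∈ range d, ‖a j‖) / ‖a d‖) := by
  by_cases hw : ‖w‖ ≤ 1
  · exact hw.trans (le_max_left _ _)
  · push Not at hw
    refine le_trans ?_ (le_max_right _ _)
    have hwpos : 0 < ‖w‖ := lt_trans zero_lt_one hw
    have had : 0 < ‖a d‖ := norm_pos_iff.2 hd
    -- `a d * w^d = - Σ_{j<d} a j w^j`
    rw [Finset.sum_range_succ] at hz
    have heq : a d * w ^ d = -(∑ j ∈ range d, a j * w ^ j) := eq_neg_of_add_eq_zero_right hz
    have hle : ‖a d‖ * ‖w‖ ^ d ≤ (∑ j ∈ range d, ‖a j‖) * ‖w‖ ^ (d - 1) := by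
      have h1 : ‖a d * w ^ d‖ = ‖a d‖ * ‖w‖ ^ d := by rw [norm_mul, norm_pow]
      rw [← h1, heq, norm_neg]
      refine (norm_sum_le _ _).trans ?_
      rw [Finset.sum_mul]
      refine Finset.sum_le_sum fun j hj => ?_
      rw [norm_mul, norm_pow]
      have hj' : j ≤ d - 1 := by have := Finset.mem_range.1 hj; omega
      exact mul_le_mul_of_nonneg_left (pow_le_pow_right₀ hw.le hj') (norm_nonneg _)
    -- divide by `‖w‖^{d-1} > 0`
    rcases Nat.eq_zero_or_pos d with rfl | hdpos
    · exfalso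
      simp at heq
      exact hd heq
    · have hpos : 0 < ‖w‖ ^ (d - 1) := pow_pos hwpos _
      have key : (‖a d‖ * ‖w‖) * ‖w‖ ^ (d - 1) ≤ (∑ j ∈ range d, ‖a j‖) * ‖w‖ ^ (d - 1) := by
        calc (‖a d‖ * ‖w‖) * ‖w‖ ^ (d - 1) = ‖a d‖ * ‖w‖ ^ d := by
              rw [mul_assoc, ← pow_succ', Nat.sub_add_cancel hdpos]
          _ ≤ _ := hle
      have hle' : ‖a d‖ * ‖w‖ ≤ ∑ j ∈ range d, ‖a j‖ := le_of_mul_le_mul_right key hpos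
      rw [le_div_iff₀ had]
      linarith [hle']

/-! ### Growth of complex polynomials -/

/-- Polynomial upper bound `‖p(s)‖ ≤ (Σ ‖coeff‖) (1 + ‖s‖)^{deg p}`. -/
theorem norm_eval_le (p : ℂ[X]) (s : ℂ) :
    ‖p.eval s‖ ≤ (∑ i ∈ range (p.natDegree + 1), ‖p.coeff i‖) * (1 + ‖s‖) ^ p.natDegree := by
  rw [Polynomial.eval_eq_sum_range, Finset.sum_mul]
  refine (norm_sum_le _ _).trans (Finset.sum_le_sum fun i hi => ?_)
  rw [norm_mul, norm_pow]
  refine mul_le_mul_of_nonneg_left ?_ (norm_nonneg _)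
  have hi' : i ≤ p.natDegree := by have := Finset.mem_range.1 hi; omega
  have h1 : ‖s‖ ^ i ≤ (1 + ‖s‖) ^ i :=
    pow_le_pow_left₀ (norm_nonneg _) (by linarith [norm_nonneg s]) i
  have h2 : (1 + ‖s‖) ^ i ≤ (1 + ‖s‖) ^ p.natDegree :=
    pow_le_pow_right₀ (by linarith [norm_nonneg s]) hi'
  exact h1.trans h2

/-- Polynomial lower bound far out: a non-zero complex polynomial is bounded below by a positive
constant outside a large disc. -/
theorem exists_norm_eval_ge (p : ℂ[X]) (hp : p ≠ 0) :
    ∃ R₀ κ : ℝ, 0 < κ ∧ ∀ s : ℂ, R₀ ≤ ‖s‖ → κ ≤ ‖p.eval s‖ := by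
  by_cases hdeg : 0 < p.degree
  · have ht : Tendsto (fun s : ℂ => ‖p.eval s‖) (cobounded ℂ) atTop :=
      p.tendsto_norm_atTop hdeg tendsto_norm_cobounded_atTop
    have hev : ∀ᶠ s in cobounded ℂ, 1 ≤ ‖p.eval s‖ := ht.eventually (eventually_ge_atTop 1)
    obtain ⟨r, -, hr⟩ := (Metric.hasBasis_cobounded_compl_closedBall (0 : ℂ)).eventually_iff.1 hev
    refine ⟨r + 1, 1, one_pos, fun s hs => hr ?_⟩
    simp only [Set.mem_compl_iff, Metric.mem_closedBall, dist_zero_right, not_le]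
    linarith
  · -- constant polynomial
    have hdeg' : p.degree ≤ 0 := not_lt.1 hdeg
    rw [Polynomial.eq_C_of_degree_le_zero hdeg'] at hp ⊢
    have hc : p.coeff 0 ≠ 0 := fun h => hp (by rw [h, map_zero])
    refine ⟨0, ‖p.coeff 0‖, norm_pos_iff.2 hc, fun s _ => ?_⟩
    rw [Polynomial.eval_C]

/-! ### Exponential polynomials `m(e^s, s)` in normal form -/


/-- A coefficient `c ∈ ℚ[S]` (as `MvPolynomial (Fin 1) ℚ`) viewed as a complex polynomial. -/
def coefC (c : MvPolynomial (Fin 1) ℚ) : ℂ[X] :=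
  (MvPolynomial.uniqueAlgEquiv ℚ (Fin 1) c).map (algebraMap ℚ ℂ)

theorem aeval_eq_eval_coefC (c : MvPolynomial (Fin 1) ℚ) (s : ℂ) :
    MvPolynomial.aeval (fun _ : Fin 1 => s) c = (coefC c).eval s := by
  rw [coefC, Polynomial.eval_map, MvPolynomial.aeval_def]
  exact (MvPolynomial.eval₂_uniqueAlgEquiv (R := ℚ) (σ := Fin 1) (f := c) (φ := algebraMap ℚ ℂ)
    (a := fun _ => s)).symm

theorem coefC_ne_zero {c : MvPolynomial (Fin 1) ℚ} (hc : c ≠ 0) : coefC c ≠ 0 := by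
  rw [coefC, Ne, Polynomial.map_eq_zero_iff (algebraMap ℚ ℂ).injective]
  exact (EmbeddingLike.map_ne_zero_iff).2 hc

/-- **Normal form**: `m(e^s, s) = Σ_{j ≤ d} g_j(s) e^{js}` with `g_j = coefC (M.coeff j)`,
`M = finSuccEquiv m` (outer variable `T = e^s`), `d = deg_T m`. -/
theorem expPoly_eq_sum (m : MvPolynomial (Fin 2) ℚ) (s : ℂ) :
    expPoly m s = ∑ j ∈ range ((MvPolynomial.finSuccEquiv ℚ 1 m).natDegree + 1),
      (coefC ((MvPolynomial.finSuccEquiv ℚ 1 m).coeff j)).eval s * cexp s ^ j := by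
  set M := MvPolynomial.finSuccEquiv ℚ 1 m with hM
  have h := eval_map_finSuccEquiv m (cexp s) s
  rw [expPoly, ← h, ← hM]
  rw [Polynomial.eval_eq_sum_range' (n := M.natDegree + 1)]
  · refine Finset.sum_congr rfl fun j _ => ?_
    rw [Polynomial.coeff_map]
    congr 1
    exact aeval_eq_eval_coefC (M.coeff j) s
  · exact Nat.lt_succ_of_le (Polynomial.natDegree_map_le)

/-- **THE EXPONENTIAL OF A LARGE ZERO IS AT MOST POLYNOMIAL IN THE ZERO** (leading-coefficient
dominance; Pólya): for a non-zero `m ∈ ℚ[T, S]` there are `R₀, C, D` with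
`‖e^s‖ ≤ max 1 (C (1 + ‖s‖)^D)` for every zero `s` of `m(e^s, s)` with `‖s‖ ≥ R₀`; equivalently
`Re s ≤ log⁺(C (1+‖s‖)^D) = O(log ‖s‖)`: zeros escape to infinity only with `|Im s| → ∞`, nearly
vertically. -/
theorem norm_exp_le_of_expPoly_eq_zero {m : MvPolynomial (Fin 2) ℚ} (hm : m ≠ 0) :
    ∃ R₀ C : ℝ, ∃ D : ℕ, 0 ≤ C ∧ ∀ s : ℂ, expPoly m s = 0 → R₀ ≤ ‖s‖ →
      ‖cexp s‖ ≤ max 1 (C * (1 + ‖s‖) ^ D) := by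
  classical
  set M := MvPolynomial.finSuccEquiv ℚ 1 m with hM
  have hM0 : M ≠ 0 := by rw [hM]; exact (EmbeddingLike.map_ne_zero_iff).2 hm
  set d := M.natDegree with hd
  set g : ℕ → ℂ[X] := fun j => coefC (M.coeff j) with hg
  have hgd : g d ≠ 0 := coefC_ne_zero (by rw [hd]; exact Polynomial.leadingCoeff_ne_zero.2 hM0)
  obtain ⟨R₀, κ, hκ, hlow⟩ := exists_norm_eval_ge (g d) hgd
  -- polynomial growth of the lower coefficients
  set Cj : ℕ → ℝ := fun j => ∑ i ∈ range ((g j).natDegree + 1), ‖(g j).coeff i‖ with hCj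
  have hCj0 : ∀ j, 0 ≤ Cj j := fun j => Finset.sum_nonneg fun i _ => norm_nonneg _
  set D : ℕ := (range d).sup fun j => (g j).natDegree with hD
  set K : ℝ := ∑ j ∈ range d, Cj j with hK
  have hK0 : 0 ≤ K := Finset.sum_nonneg fun j _ => hCj0 j
  refine ⟨R₀, K / κ, D, div_nonneg hK0 hκ.le, fun s hs hR => ?_⟩
  have hP1 : 1 ≤ 1 + ‖s‖ := by linarith [norm_nonneg s]
  -- the zero, in normal form
  have hz : ∑ j ∈ range (d + 1), (g j).eval s * cexp s ^ j = 0 := by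
    rw [← hs, expPoly_eq_sum]
  have hcb := cauchy_bound (fun j => (g j).eval s) (cexp s) (d := d)
    (fun h0 => (lt_of_lt_of_le hκ (hlow s hR)).ne' (by rw [h0, norm_zero])) hz
  refine hcb.trans (max_le_max le_rfl ?_)
  -- `Σ_{j<d} ‖g_j(s)‖ / ‖g_d(s)‖ ≤ (K/κ)(1+‖s‖)^D`
  have hnum : ∑ j ∈ range d, ‖(g j).eval s‖ ≤ K * (1 + ‖s‖) ^ D := by
    rw [hK, Finset.sum_mul]
    refine Finset.sum_le_sum fun j hj => ?_
    refine (norm_eval_le (g j) s).trans ?_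
    refine mul_le_mul_of_nonneg_left ?_ (hCj0 j)
    exact pow_le_pow_right₀ hP1 (Finset.le_sup (f := fun j => (g j).natDegree) hj)
  have hden : κ ≤ ‖(g d).eval s‖ := hlow s hR
  have hden0 : 0 < ‖(g d).eval s‖ := lt_of_lt_of_le hκ hden
  calc (∑ j ∈ range d, ‖(g j).eval s‖) / ‖(g d).eval s‖
      ≤ (K * (1 + ‖s‖) ^ D) / κ := by
        exact div_le_div₀ (mul_nonneg hK0 (pow_nonneg (by linarith) _)) hnum hκ hden
    _ = K / κ * (1 + ‖s‖) ^ D := by ring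

/-- Coefficients below the trailing degree vanish, so their `coefC` vanish. -/
theorem coefC_coeff_eq_zero_of_lt {M : Polynomial (MvPolynomial (Fin 1) ℚ)} {j : ℕ}
    (hj : j < M.natTrailingDegree) : coefC (M.coeff j) = 0 := by
  rw [Polynomial.coeff_eq_zero_of_lt_natTrailingDegree hj, coefC, map_zero, Polynomial.map_zero]

/-- **Mirror bound: the exponential of a large zero is at least INVERSE-polynomial** —
`‖e^{-s}‖ ≤ max 1 (C (1+‖s‖)^D)`, i.e. `Re s ≥ −log⁺(C(1+‖s‖)^D)` (trailing-coefficient dominance).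
Together with `norm_exp_le_of_expPoly_eq_zero`: `|Re s| = O(log ‖s‖)` on the zero set. -/
theorem norm_exp_neg_le_of_expPoly_eq_zero {m : MvPolynomial (Fin 2) ℚ} (hm : m ≠ 0) :
    ∃ R₀ C : ℝ, ∃ D : ℕ, 0 ≤ C ∧ ∀ s : ℂ, expPoly m s = 0 → R₀ ≤ ‖s‖ →
      ‖cexp (-s)‖ ≤ max 1 (C * (1 + ‖s‖) ^ D) := by
  classical
  set M := MvPolynomial.finSuccEquiv ℚ 1 m with hM
  have hM0 : M ≠ 0 := by rw [hM]; exact (EmbeddingLike.map_ne_zero_iff).2 hm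
  set d := M.natDegree with hd
  set t := M.natTrailingDegree with ht
  have htd : t ≤ d := Polynomial.natTrailingDegree_le_natDegree M
  set g : ℕ → ℂ[X] := fun j => coefC (M.coeff j) with hg
  have hgt : g t ≠ 0 := coefC_ne_zero (by
    rw [ht]; exact mt Polynomial.trailingCoeff_eq_zero.1 hM0)
  obtain ⟨R₀, κ, hκ, hlow⟩ := exists_norm_eval_ge (g t) hgt
  set Cj : ℕ → ℝ := fun j => ∑ i ∈ range ((g j).natDegree + 1), ‖(g j).coeff i‖ with hCj
  have hCj0 : ∀ j, 0 ≤ Cj j := fun j => Finset.sum_nonneg fun i _ => norm_nonneg _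
  set D : ℕ := (range (d + 1)).sup fun j => (g j).natDegree with hD
  set K : ℝ := ∑ j ∈ range (d + 1), Cj j with hK
  have hK0 : 0 ≤ K := Finset.sum_nonneg fun j _ => hCj0 j
  refine ⟨R₀, K / κ, D, div_nonneg hK0 hκ.le, fun s hs hR => ?_⟩
  have hP1 : 1 ≤ 1 + ‖s‖ := by linarith [norm_nonneg s]
  have hz : ∑ j ∈ range (d + 1), (g j).eval s * cexp s ^ j = 0 := by
    rw [← hs, expPoly_eq_sum]
  -- reflected coefficients `a k = g_{d-k}(s)`, variable `w' = e^{-s}`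
  set a : ℕ → ℂ := fun k => (g (d - k)).eval s with ha
  set d' := d - t with hd'
  have hrefl : ∑ k ∈ range (d + 1), a k * cexp (-s) ^ k = 0 := by
    have h1 : ∑ k ∈ range (d + 1), a k * cexp (-s) ^ k =
        ∑ j ∈ range (d + 1), (g j).eval s * cexp (-s) ^ (d - j) := by
      rw [← Finset.sum_range_reflect (fun j => (g j).eval s * cexp (-s) ^ (d - j)) (d + 1)]
      refine Finset.sum_congr rfl fun k hk => ?_
      have hk' : k ≤ d := Nat.lt_succ_iff.1 (Finset.mem_range.1 hk)
      simp only [ha, Nat.add_sub_cancel]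
      rw [Nat.sub_sub_self hk']
    rw [h1]
    have h2 : ∑ j ∈ range (d + 1), (g j).eval s * cexp (-s) ^ (d - j) =
        cexp (-s) ^ d * ∑ j ∈ range (d + 1), (g j).eval s * cexp s ^ j := by
      rw [Finset.mul_sum]
      refine Finset.sum_congr rfl fun j hj => ?_
      have hj' : j ≤ d := Nat.lt_succ_iff.1 (Finset.mem_range.1 hj)
      have hpow : cexp (-s) ^ (d - j) = cexp (-s) ^ d * cexp s ^ j := by
        have : cexp (-s) ^ d = cexp (-s) ^ (d - j) * cexp (-s) ^ j := by
          rw [← pow_add, Nat.sub_add_cancel hj']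
        rw [this, mul_assoc, ← mul_pow, ← Complex.exp_add, neg_add_cancel, Complex.exp_zero,
          one_pow, mul_one]
      rw [hpow]; ring
    rw [h2, hz, mul_zero]
  -- terms with `k > d'` vanish (coefficients below the trailing degree)
  have hvan : ∀ k, d' < k → k ≤ d → a k = 0 := by
    intro k hk hkd
    simp only [ha]
    have : d - k < t := by rw [hd'] at hk; omega
    rw [hg]
    simp only
    rw [coefC_coeff_eq_zero_of_lt (by rw [← ht]; exact this), Polynomial.eval_zero]
  have hz' : ∑ k ∈ range (d' + 1), a k * cexp (-s) ^ k = 0 := by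
    rw [← hrefl]
    have hsub : range (d' + 1) ⊆ range (d + 1) :=
      Finset.range_subset_range.2 (Nat.succ_le_succ (by rw [hd']; exact Nat.sub_le d t))
    refine Finset.sum_subset hsub fun k hk hk' => ?_
    have h1 := Finset.mem_range.1 hk
    have h2 : ¬ k < d' + 1 := fun h => hk' (Finset.mem_range.2 h)
    rw [hvan k (by omega) (by omega), zero_mul]
  have had' : a d' = (g t).eval s := by
    simp only [ha, hd']
    rw [Nat.sub_sub_self htd]
  have hcb := cauchy_bound a (cexp (-s)) (d := d')
    (fun h0 => (lt_of_lt_of_le hκ (hlow s hR)).ne' (by rw [← had', h0, norm_zero])) hz'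
  refine hcb.trans (max_le_max le_rfl ?_)
  have hnum : ∑ k ∈ range d', ‖a k‖ ≤ K * (1 + ‖s‖) ^ D := by
    have hterm : ∀ k ∈ range d', ‖a k‖ ≤ Cj (d - k) * (1 + ‖s‖) ^ D := by
      intro k hk
      refine (norm_eval_le (g (d - k)) s).trans ?_
      refine mul_le_mul_of_nonneg_left ?_ (hCj0 _)
      refine pow_le_pow_right₀ hP1 ?_
      exact Finset.le_sup (f := fun j => (g j).natDegree) (Finset.mem_range.2 (by omega))
    refine (Finset.sum_le_sum hterm).trans ?_
    rw [← Finset.sum_mul]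
    refine mul_le_mul_of_nonneg_right ?_ (pow_nonneg (by linarith) _)
    -- `Σ_{k<d'} C_{d-k} ≤ Σ_{j ≤ d} C_j` by the injective reindexing `k ↦ d - k`
    have hinj : Set.InjOn (fun k => d - k) (range d' : Finset ℕ) := by
      intro k hk k' hk' h
      have hk1 := Finset.mem_range.1 (Finset.mem_coe.1 hk)
      have hk2 := Finset.mem_range.1 (Finset.mem_coe.1 hk')
      simp only at h
      omega
    rw [← Finset.sum_image hinj]
    refine Finset.sum_le_sum_of_subset_of_nonneg ?_ fun j _ _ => hCj0 j
    intro j hj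
    rw [Finset.mem_image] at hj
    obtain ⟨k, hk, rfl⟩ := hj
    exact Finset.mem_range.2 (by omega)
  have hden : κ ≤ ‖(g t).eval s‖ := hlow s hR
  rw [had']
  calc (∑ k ∈ range d', ‖a k‖) / ‖(g t).eval s‖
      ≤ (K * (1 + ‖s‖) ^ D) / κ :=
        div_le_div₀ (mul_nonneg hK0 (pow_nonneg (by linarith) _)) hnum hκ hden
    _ = K / κ * (1 + ‖s‖) ^ D := by ring

/-- **Vertical escape, packaged**: `|Re s| ≤ log (max 1 (C (1+‖s‖)^D))` for the large zeros. -/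
theorem abs_re_le_of_expPoly_eq_zero {m : MvPolynomial (Fin 2) ℚ} (hm : m ≠ 0) :
    ∃ R₀ C : ℝ, ∃ D : ℕ, 0 ≤ C ∧ ∀ s : ℂ, expPoly m s = 0 → R₀ ≤ ‖s‖ →
      |s.re| ≤ Real.log (max 1 (C * (1 + ‖s‖) ^ D)) := by
  obtain ⟨R₁, C₁, D₁, hC₁, h₁⟩ := norm_exp_le_of_expPoly_eq_zero hm
  obtain ⟨R₂, C₂, D₂, hC₂, h₂⟩ := norm_exp_neg_le_of_expPoly_eq_zero hm
  refine ⟨max R₁ R₂, max C₁ C₂, max D₁ D₂, le_max_of_le_left hC₁, fun s hs hR => ?_⟩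
  have hP1 : 1 ≤ 1 + ‖s‖ := by linarith [norm_nonneg s]
  have hbig : ∀ (C : ℝ) (D : ℕ), 0 ≤ C → C ≤ max C₁ C₂ → D ≤ max D₁ D₂ →
      max 1 (C * (1 + ‖s‖) ^ D) ≤ max 1 (max C₁ C₂ * (1 + ‖s‖) ^ max D₁ D₂) := by
    intro C D hC hCle hDle
    refine max_le_max le_rfl ?_
    exact mul_le_mul hCle (pow_le_pow_right₀ hP1 hDle) (pow_nonneg (by linarith) _)
      (hC.trans hCle)
  have e1 : ‖cexp s‖ = Real.exp s.re := Complex.norm_exp s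
  have e2 : ‖cexp (-s)‖ = Real.exp (-s.re) := by rw [Complex.norm_exp]; simp
  have hr : Real.exp s.re ≤ max 1 (max C₁ C₂ * (1 + ‖s‖) ^ max D₁ D₂) := by
    rw [← e1]
    exact (h₁ s hs (le_trans (le_max_left _ _) hR)).trans (hbig C₁ D₁ hC₁ (le_max_left _ _) (le_max_left _ _))
  have hl : Real.exp (-s.re) ≤ max 1 (max C₁ C₂ * (1 + ‖s‖) ^ max D₁ D₂) := by
    rw [← e2]
    exact (h₂ s hs (le_trans (le_max_right _ _) hR)).trans (hbig C₂ D₂ hC₂ (le_max_right _ _) (le_max_right _ _))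
  have hpos : 0 < max 1 (max C₁ C₂ * (1 + ‖s‖) ^ max D₁ D₂) := lt_of_lt_of_le one_pos (le_max_left _ _)
  rw [abs_le]
  constructor
  · have := (Real.le_log_iff_exp_le hpos).2 hl
    linarith
  · exact (Real.le_log_iff_exp_le hpos).2 hr

/-- **Zeros with bounded imaginary part are bounded** ("escape is VERTICAL"): for each `T` there is
`R` with `‖s‖ < R` for every zero `s` of `m(e^s, s)` with `|Im s| ≤ T` (exp beats every polynomial). -/
theorem norm_lt_of_expPoly_eq_zero_of_im_le {m : MvPolynomial (Fin 2) ℚ} (hm : m ≠ 0) (T : ℝ) :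
    ∃ R : ℝ, ∀ s : ℂ, expPoly m s = 0 → |s.im| ≤ T → ‖s‖ < R := by
  obtain ⟨R₀, C, D, hC, h⟩ := abs_re_le_of_expPoly_eq_zero hm
  -- `C (1+r)^D e^{-(r-T)} → 0`
  have ht0 : Tendsto (fun r : ℝ => (1 + r) ^ D * Real.exp (-(1 + r))) atTop (𝓝 0) :=
    (Real.tendsto_pow_mul_exp_neg_atTop_nhds_zero D).comp (tendsto_atTop_add_const_left atTop 1 tendsto_id)
  have ht : Tendsto (fun r : ℝ => C * Real.exp (1 + T) * ((1 + r) ^ D * Real.exp (-(1 + r)))) atTop (𝓝 0) := by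
    simpa using ht0.const_mul (C * Real.exp (1 + T))
  have hev : ∀ᶠ r in atTop, C * Real.exp (1 + T) * ((1 + r) ^ D * Real.exp (-(1 + r))) < 1 :=
    ht (Iio_mem_nhds one_pos)
  obtain ⟨R₁, hR₁⟩ := Filter.eventually_atTop.1 hev
  set R := max (max R₀ R₁) (T + 1) with hR
  refine ⟨R, fun s hs hT => ?_⟩
  by_contra hnot
  have hRs : R ≤ ‖s‖ := not_lt.1 hnot
  have hR0s : R₀ ≤ ‖s‖ := le_trans (le_trans (le_max_left _ _) (le_max_left _ _)) hRs
  have hR1s : R₁ ≤ ‖s‖ := le_trans (le_trans (le_max_right _ _) (le_max_left _ _)) hRs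
  have hTs : T + 1 ≤ ‖s‖ := le_trans (le_max_right _ _) hRs
  have hre := h s hs hR0s
  -- `‖s‖ - T ≤ |re s|`
  have hre_ge : ‖s‖ - T ≤ |s.re| := by
    have := Complex.norm_le_abs_re_add_abs_im s
    linarith
  have hpos : 0 < max 1 (C * (1 + ‖s‖) ^ D) := lt_of_lt_of_le one_pos (le_max_left _ _)
  have hexp : Real.exp (‖s‖ - T) ≤ max 1 (C * (1 + ‖s‖) ^ D) := by
    have h1 : Real.exp |s.re| ≤ max 1 (C * (1 + ‖s‖) ^ D) := by
      rwa [← Real.le_log_iff_exp_le hpos]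
    exact (Real.exp_le_exp.2 hre_ge).trans h1
  -- but exp beats the polynomial at `‖s‖ ≥ R₁`
  have hsmall := hR₁ ‖s‖ hR1s
  have hgt1 : 1 < Real.exp (‖s‖ - T) := by
    rw [← Real.exp_zero]; exact Real.exp_lt_exp.2 (by linarith)
  rcases le_max_iff.1 hexp with h1 | h2
  · linarith
  · -- `exp(‖s‖-T) ≤ C (1+‖s‖)^D` contradicts `C e^{1+T} (1+‖s‖)^D e^{-(1+‖s‖)} < 1`
    have hkey : C * (1 + ‖s‖) ^ D = (C * Real.exp (1 + T) * ((1 + ‖s‖) ^ D * Real.exp (-(1 + ‖s‖)))) *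
        Real.exp (‖s‖ - T) := by
      have e : Real.exp (1 + T) * Real.exp (-(1 + ‖s‖)) * Real.exp (‖s‖ - T) = 1 := by
        rw [← Real.exp_add, ← Real.exp_add, show 1 + T + -(1 + ‖s‖) + (‖s‖ - T) = 0 by ring,
          Real.exp_zero]
      calc C * (1 + ‖s‖) ^ D = C * (1 + ‖s‖) ^ D * (Real.exp (1 + T) * Real.exp (-(1 + ‖s‖)) * Real.exp (‖s‖ - T)) := by
            rw [e, mul_one]
        _ = _ := by ring
    have hposexp : 0 < Real.exp (‖s‖ - T) := Real.exp_pos _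
    have : C * (1 + ‖s‖) ^ D < 1 * Real.exp (‖s‖ - T) := by
      rw [hkey]; exact mul_lt_mul_of_pos_right hsmall hposexp
    linarith


/-- **§19 HEADLINE — LOCUS POINTS WITH BOUNDED IMAGINARY PARTS ARE FINITE (rank 2).**  For `x ∈ ℂ²`
with `trdeg ℚ(x, eˣ) < 2`, the tuples `v ∈ 𝒵_W` with `|Im vᵢ| ≤ T` for both `i` form a finite set: the
only way to infinitely many mates is VERTICAL ESCAPE `|Im x'ᵢ| → ∞` for some `i`. -/
theorem locusPts_finite_of_im_bounded {x : Fin 2 → ℂ}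
    (htr : Algebra.trdeg ℚ ↥(IntermediateField.adjoin ℚ (Set.range x ∪ Set.range (cexp ∘ x))) < (2 : Cardinal))
    (T : ℝ) :
    {v : Fin 2 → ℂ | (∀ i, |(v i).im| ≤ T) ∧ ∀ p : MvPolynomial (Fin 2 ⊕ Fin 2) ℚ,
        MvPolynomial.aeval (Sum.elim x (cexp ∘ x)) p = 0 →
        MvPolynomial.aeval (Sum.elim v (cexp ∘ v)) p = 0}.Finite := by
  choose m hm0 hm using fun i => exists_coord_expPoly htr i
  choose R hR using fun i => norm_lt_of_expPoly_eq_zero_of_im_le (hm0 i) T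
  refine (locusPts_bounded_finite htr (max (R 0) (R 1))).subset fun v hv => ⟨fun i => ?_, hv.2⟩
  have hlt := hR i (v i) (hm i v hv.2) (hv.1 i)
  fin_cases i
  · exact hlt.le.trans (le_max_left _ _)
  · exact hlt.le.trans (le_max_right _ _)

/-- … so an INFINITE family of locus points (e.g. infinitely many mates of a rank-2 first failure) has
UNBOUNDED imaginary parts. -/
theorem exists_large_im_of_infinite {x : Fin 2 → ℂ}
    (htr : Algebra.trdeg ℚ ↥(IntermediateField.adjoin ℚ (Set.range x ∪ Set.range (cexp ∘ x))) < (2 : Cardinal))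
    {M : Set (Fin 2 → ℂ)} (hinf : M.Infinite)
    (hM : ∀ v ∈ M, ∀ p : MvPolynomial (Fin 2 ⊕ Fin 2) ℚ,
        MvPolynomial.aeval (Sum.elim x (cexp ∘ x)) p = 0 →
        MvPolynomial.aeval (Sum.elim v (cexp ∘ v)) p = 0) (T : ℝ) :
    ∃ v ∈ M, ∃ i, T < |(v i).im| := by
  by_contra h
  push Not at h
  exact hinf ((locusPts_finite_of_im_bounded htr T).subset fun v hv => ⟨h v hv, hM v hv⟩)

/-- **Exponentials of large locus points are polynomially bounded above and below** (packaging §19 for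
the two coordinate exponential polynomials): there are `R₀, C, D` with
`max ‖e^{vᵢ}‖ ‖e^{-vᵢ}‖ ≤ max 1 (C (1+‖vᵢ‖)^D)` for every `v ∈ 𝒵_W` and `i` with `‖vᵢ‖ ≥ R₀`. -/
theorem exp_coord_polynomially_bounded {x : Fin 2 → ℂ}
    (htr : Algebra.trdeg ℚ ↥(IntermediateField.adjoin ℚ (Set.range x ∪ Set.range (cexp ∘ x))) < (2 : Cardinal)) :
    ∃ R₀ C : ℝ, ∃ D : ℕ, ∀ v : Fin 2 → ℂ, (∀ p : MvPolynomial (Fin 2 ⊕ Fin 2) ℚ,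
        MvPolynomial.aeval (Sum.elim x (cexp ∘ x)) p = 0 →
        MvPolynomial.aeval (Sum.elim v (cexp ∘ v)) p = 0) →
      ∀ i, R₀ ≤ ‖v i‖ → max ‖cexp (v i)‖ ‖cexp (-(v i))‖ ≤ max 1 (C * (1 + ‖v i‖) ^ D) := by
  choose m hm0 hm using fun i => exists_coord_expPoly htr i
  choose R₁ C₁ D₁ hC₁ h₁ using fun i => norm_exp_le_of_expPoly_eq_zero (hm0 i)
  choose R₂ C₂ D₂ hC₂ h₂ using fun i => norm_exp_neg_le_of_expPoly_eq_zero (hm0 i)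
  set R₀ := max (max (R₁ 0) (R₁ 1)) (max (R₂ 0) (R₂ 1))
  set C := max (max (C₁ 0) (C₁ 1)) (max (C₂ 0) (C₂ 1))
  set D := max (max (D₁ 0) (D₁ 1)) (max (D₂ 0) (D₂ 1))
  refine ⟨R₀, C, D, fun v hv i hR => ?_⟩
  have hP1 : 1 ≤ 1 + ‖v i‖ := by linarith [norm_nonneg (v i)]
  have hmono : ∀ (C' : ℝ) (D' : ℕ), 0 ≤ C' → C' ≤ C → D' ≤ D →
      max 1 (C' * (1 + ‖v i‖) ^ D') ≤ max 1 (C * (1 + ‖v i‖) ^ D) := by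
    intro C' D' hC' hC'le hD'le
    refine max_le_max le_rfl ?_
    exact mul_le_mul hC'le (pow_le_pow_right₀ hP1 hD'le) (pow_nonneg (by linarith) _) (hC'.trans hC'le)
  have hz := hm i v hv
  refine max_le ?_ ?_
  · have hR₁ : R₁ i ≤ ‖v i‖ := by
      refine le_trans ?_ hR
      fin_cases i
      · exact le_trans (le_max_left _ _) (le_max_left _ _)
      · exact le_trans (le_max_right _ _) (le_max_left _ _)
    refine (h₁ i (v i) hz hR₁).trans (hmono _ _ (hC₁ i) ?_ ?_)
    · fin_cases i
      · exact le_trans (le_max_left _ _) (le_max_left _ _)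
      · exact le_trans (le_max_right _ _) (le_max_left _ _)
    · fin_cases i
      · exact le_trans (le_max_left _ _) (le_max_left _ _)
      · exact le_trans (le_max_right _ _) (le_max_left _ _)
  · have hR₂ : R₂ i ≤ ‖v i‖ := by
      refine le_trans ?_ hR
      fin_cases i
      · exact le_trans (le_max_left _ _) (le_max_right _ _)
      · exact le_trans (le_max_right _ _) (le_max_right _ _)
    refine (h₂ i (v i) hz hR₂).trans (hmono _ _ (hC₂ i) ?_ ?_)
    · fin_cases i
      · exact le_trans (le_max_left _ _) (le_max_right _ _)
      · exact le_trans (le_max_right _ _) (le_max_right _ _)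
    · fin_cases i
      · exact le_trans (le_max_left _ _) (le_max_right _ _)
      · exact le_trans (le_max_right _ _) (le_max_right _ _)

end Summit.Schanuel.Schanuel.Cruxes.MinimalCounterexampleInAcl.DisproofRankTwo

end
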